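import Literature.MathematicalPhysics.QuantumFieldTheory.Balaban1983to89.B8Eq178Averages
import Literature.MathematicalPhysics.QuantumFieldTheory.Balaban1983to89.B8Thm2LogB

/-!
# `Balaban1983to89.B8Eq131Derivation` — [Balaban1985RegularSpaces] Sect. B pp. 81–82: the DERIVATION «(1.29), (1.30) ⇒
# (1.31)» of the averages of `U₁ = U′^{u⁻¹}` from the formulas (84), (87), (92), (97), (99), (105) of [3], PROVED on the
# `ℤᵈ` carriers of the lineage — the two middle equalities of (1.31) that `B8Thm2LogB` (HONEST SCOPE (i)) left uncertified

statement-level skeleton of published theorems with citation tags; proofs where landed; nothing here is a claim about the Yang–Mills mass gap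

CITATION HEADER.  T. Bałaban, *Spaces of regular gauge field configurations on a lattice and gauge fixing conditions*,
Commun. Math. Phys. **99** (1985) 75–102 [Balaban1985RegularSpaces] ("B8"; PDF page = journal page − 74; pp. 81–82 READ AS
IMAGES on the ×2 renders `run/shared/lean/pub/pub-balaban/b2b-balaban-ref1/pages/1985-cmp99-regular-spaces-gauge-fixing/
1985-cmp99-regular-spaces-gauge-fixing-p007-x2.png`, `-p008-x2.png`); "[3]" = T. Bałaban, *Averaging operations for lattice
gauge theories*, Commun. Math. Phys. **98** (1985) 17–51 [Balaban1985Averaging] ("B7"), Sect. C pp. 29–33, formulas (67),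
(69)–(71), (78)–(80), (84)–(88), (92), (97), (99), (105).  Unit `lit-balaban-r05` gen 5 (B8 fold owner; SKELETON row
**B8.Eq1.31**), 2026-08-21.  Companion of `B8Thm2LogB` (b2b gen. 22: the DEFINITIONS (1.31) `Bint`/`crossSum`/`crossMid`/
`Bcross` and the bound (1.37), whose HONEST SCOPE (i) reads: *"The two middle EQUALITIES of (1.31) — `(Ū₁ʲ)_b = V′_b` on
interior bonds and `(Ū₁ʲ)_b = exp[−i Σ …]V′_b` on crossing bonds — are B8's reading of B7 (87), (92), (97), (99), (105)
applied to (1.29)–(1.30); they are NOT certified here"*) and of the b07 leaves that certified those formulas of [3] AT A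
GENERAL BACKGROUND afterwards: `B7Eq84Concrete` ((79)/(80) `uavg`, (67) `AxialGauge`, (84) `eq84`, (81) ⇔ (87)
`eq81_iff_eq87`), `B7Eq92Concrete` ((55) `mgauge`, (58) `tHol`, (69) `tildIter`, (82) `wframe`, (90)/(91) `dbavgCovIter`,
(97) `vcov`, (70)/(71) `tildIter_mgauge`), `B7Eq99Concrete` ((78) `savg`/`R0avg`, (85) `wrec`, (92) `eq92`, (99)
`wrec_eq_vcov`), `B7Eq106Concrete` ((105) `eq105`, `mgauge_mgauge`).  What this file adds is the LOCALISATION that B8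
needs — in [3] the gauge conditions (67), (81) hold on the whole lattice, in B8 the axial conditions (1.19) hold in the
towers `Bʲ(y)` under the sites `y ∈ Λ_j` and (1.29) holds AT those sites — and the assembly of print's p. 81–82 argument.

WHAT IS PRINTED (verbatim, p. 81 [PDF 7]).  *"The configurations U′ satisfy the equations Ũ′ʲ = V(Ū₀ʲ)⁻¹ on Λ_j, hence U₁
satisfies
  (Ũ₁^{u j})_b = u(b₋)(Ũ₁ʲ)_b R̄ʲ_{0,b} u⁻¹(b₊) = V_b(Ū₀ʲ)_b⁻¹,  b ∈ Λ_j.   (1.30)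
Let us notice that we do not assume that U₀ satisfies (1.13), i.e. that U₀ ∈ 𝔅_k(𝔅_k, V), hence the right-hand side in
(1.30) generally is not equal to 1. We will assume only that it is close to 1.  In [3] we have determined the gauge
transformation u in terms of the configuration U₁. We refer the reader especially to the formulas (87), (99), (97), and
(105) of that paper. If both end-points b₋, b₊ of a bond b belong to Λ_j, then the expression on the left-hand side of
(1.30) is equal to (Ū₁ʲ)_b by (92) of [3]. If a bond b crosses the boundary of Λ_j, then one of the end-points belongs
to Λ_j, e.g. b₊ ∈ Λ_j, and another to Λ_{j−1}, b₋ ∈ Λ_{j−1}. In this case the formulas (97), (99), and (87) of [3] imply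
  (Ũ₁^{u j})_b = \overline{R̄^{j−1}_{0,b₋}Ū₁^{j−1}} (Ū₁ʲ)_b = V_b(Ū₀ʲ)_b⁻¹,
where by the formula (105) of [3]
  \overline{R̄^{j−1}_{0,b₋}Ū₁^{j−1}} = exp[i Σ_{x∈B(b₋)} L^{−d} (1/i) log(R̄^{j−1}_{0,b₋}Ū₁^{j−1})(Γ_{b₋,x})]."*
p. 82 [PDF 8]: *"All sites of the contours Γ_{b₋,x} belong to Λ_{j−1}, hence Ū₁^{j−1} in the above formula is equal to
V(Ū₀^{j−1})⁻¹. Let us denote V(Ū₀ʲ)⁻¹ = V′. We can write Eq. (1.30) as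
  (Ū₁ʲ)_b = V′_b = exp iB_b,  if b ⊂ Λ_j (i.e., b₋, b₊ ∈ Λ_j),
  (Ū₁ʲ)_b = exp[−i Σ_{x∈B(b₋)} L^{−d} (1/i) log(R̄^{j−1}_{0,b₋}V′)(Γ_{b₋,x})] V′_b = exp iB_b,  if b₋ ∈ Λ_{j−1}, b₊ ∈ Λ_j,   (1.31)
or (1/i) log Ū₁ʲ = B on Λ_j, j = 0, 1, …, k, where the configuration B is defined by the above equations."*
Also used: (1.29) p. 81 *"(\overline{R₀u}ʲ)(y) = 1 for y ∈ Λ_j, j = 0, 1, …, k"*, (1.17) p. 78 *"U′ᵘ(x, x′) =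
u(x)U′(x, x′)R(U₀(x, x′))u⁻¹(x′)"*, (1.19)–(1.20) p. 79 (the axial gauge `Ax_k(𝔅_k, U₀)`: *"(R̄ⁿ_{0,x_{n+1}}Ũ′ⁿ)(Γ_{x_{n+1},x_n})
= 1"* for the block contours of the tower `x_n ∈ B(x_{n+1})` under `x_j ∈ Λ_j`, *"Ũ′ⁿ = (\overline{U′U₀})ⁿ(Ū₀ⁿ)⁻¹"*), (1.13)
p. 78 (*"Ūʲ = V on Λ_j"*).

READING (located).  (a) In (1.30)–(1.31) B8 writes a single bar `Ū₁ʲ` for the object that [3] (88)–(92) calls `U̿₁ʲ` — *"We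
may consider this expression as a new averaging operation of k-th order acting on a configuration U₁"* ([3] p. 31, after
(88)); the sentence *"the left-hand side of (1.30) is equal to (Ū₁ʲ)_b by (92) of [3]"* fixes this reading, and (92) is
`(\overline{R_{0,b₋}U₁^{(k)}})⁻¹Ũ₁^kR̄^k_{0,b}\overline{R_{0,b₊}U₁^{(k)}} = (U̿₁^k)_b`.  So `Ū₁ʲ` ↦ `B7Eq92Concrete.dbavgCovIter L U₀ U₁ j`.
(b) `U′ = U₁ᵘ` in the transformation law (1.17) relative to `U₀` IS [3] (55) `B7Eq92Concrete.mgauge U₀ u U₁` (`eq117_eq_mgauge`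
below; `U₁ = U′^{u⁻¹}` conversely, `mgauge_inv_mgauge`).  (c) Levels are read on the unit lattice as everywhere in the
lineage (`B7Prop2Explicit.rescale`): a level-`j` site `y : Site d`, its block `B(y)` of level-`(j−1)` sites = `L•y + [0, L)ᵈ`
(`boxVec`), the gauge function read at level `j` = `uLev L u j` (`u_j(y) = u(Lʲy)`), a level-`j` bond `b = ⟨y, y + e_κ⟩`.
Print's crossing bond `b₋ ∈ Λ_{j−1}, b₊ ∈ Λ_j` is stated here one level up (`j ↦ j + 1`, no truncated subtraction): a
level-`(j+1)` bond whose initial point, READ ON THE LEVEL-`j` LATTICE as the corner `L•y` of its block, is a `Λ_j`-site.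
(d) The HYPOTHESES of the theorems are print's, LOCALISED: (87) of [3] at a site (`uLev L u j y = (wrec L U₀ U₁ j y)⁻¹`, i.e.
*"u in terms of U₁"*), which §3 derives from (1.29) at the site and (1.19) in the tower under it; (1.13) at a bond
(`avgIter L (U′ * U₀) j y κ = V y κ`); for the crossing line, (87) and (1.13) on the block `B(b₋)` (*"All sites of the
contours Γ_{b₋,x} belong to Λ_{j−1}"*), as box hypotheses over `[L•y, L•y + (L−1)𝟙]` (`B8Thm2LogB.blockTop`).

WHAT THIS MODULE PROVIDES (all `theorem`s, no definition, no `Prop`-valued fact; axioms standard).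
§1 DICTIONARY/BRIDGES between the b2b typing of B8 and the b07 typing of [3]: `eq117_eq_mgauge` ((1.17) = (55)),
   `mgauge_inv_mgauge` (`U₁ = U′^{u⁻¹}`), `pert_avgIter_eq_tildIter` ((1.20) `Ũ′ⁿ` = (69) `tildIter`), `covProd_eq_tHol` (the
   (1.19)-product `B8Lemma1NonAbelian.covProd` = the twisted transport (58) `B7Eq92Concrete.tHol` on forward contours),
   `ax119_iff_ax67` ((1.19) at a block ⟺ (67) there), `tHol_congr_of_agree` (locality of (58) along a block contour).
§0 (before it) the tower geometry of `B8Ineq132.Under` / the block box (`under_zero_iff`, `under_one_block`,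
   `under_one_corner`, `under_succ_of_under_block`, `inBox_block`, `inBox_corner`).
§2 `eq84_local` — [3] (84) *"(\overline{R₀u}ʲ)(x_j) = u(x_j)\overline{R_{0,x_j}U₁}^{(j)}"* AT ONE SITE `y` from the axial
   conditions (1.19)/(67) in the tower `Bʲ(y)` only (print's induction, `B7Eq84Concrete.eq84`, localised with
   `B8Ineq132.Under`); `eq87_local` — (1.29) at `y` then gives (87) *"u(y) = (\overline{R_{0,y}U₁^{(k)}})⁻¹"* at `y`.
§3 `eq87_of_inAx_restr129` — for the TYPED classes of the tree: `U′U₀ ∈ Ax_k(𝔅_k, U₀)` (`B8Eq119TwistedAxial.InAx`) and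
   (1.29) (`B8Eq119TwistedAxial.Restr129`, = `uavg = 1` by `B8Eq178Averages.restr129_iff_uavg`) give (87) at every
   `y ∈ Λ_j`, `j ≤ k` — print's *"In [3] we have determined the gauge transformation u in terms of the configuration U₁"*.
§4 (1.30)/(1.31) on INTERIOR bonds: `eq130_lhs` ((1.30) first equality = (71) of [3], pointer), `eq130_interior` (*"the
   left-hand side of (1.30) is equal to (Ū₁ʲ)_b by (92) of [3]"*: (87) at `b₋`, `b₊` ⇒ `Ũ′ʲ_b = (U̿₁ʲ)_b`, via
   `B7Eq99Concrete.eq92`), `eq131_interior` (+ (1.13) at `b` ⇒ **`(Ū₁ʲ)_b = V_b(Ū₀ʲ)_b⁻¹ = V′_b`**, first line of (1.31)),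
   `eq131_interior_expIB` (`= exp iB_b`, `B_b = B8Thm2LogB.Bint V′_b`, inside the domain of `log`).
§5 CROSSING bonds: `eq130_crossing` (*"(97), (99), and (87) of [3] imply (Ũ₁^{u j})_b = \overline{R̄^{j−1}_{0,b₋}Ū₁^{j−1}}(Ū₁ʲ)_b"*:
   (87) at `b₋` one level down and at `b₊` ⇒ `Ũ′_b = \overline{R̄_{0,b₋}U̿₁}·(U̿₁)_b`, the factor being `B7Eq92Concrete.wframe`,
   via `vcov_succ`/`wrec_eq_vcov`/`eq92`), `eq105_wframe` ((105): that factor `= exp[Σ_{x∈B(b₋)} L^{−d} log(R̄_{0,b₋}U̿₁)(Γ_{b₋,x})]`),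
   `dbavg_agree_of_block` (*"All sites of the contours Γ_{b₋,x} belong to Λ_{j−1}, hence Ū₁^{j−1} … is equal to
   V(Ū₀^{j−1})⁻¹"*: (87) + (1.13) on the block ⇒ `U̿₁ = V′` on its bonds), and **`eq131_crossing`**: the second line of
   (1.31) LITERALLY in `B8Thm2LogB`'s vocabulary, `(Ū₁ʲ)_b = crossMid L Ū₀^{j−1} V′ b₋ V′_b = exp[−i Σ_{x∈B(b₋)} L^{−d} (1/i)
   log(R̄^{j−1}_{0,b₋}V′)(Γ_{b₋,x})]·V′_b` — so `B8Thm2LogB.exp_I_smul_Bcross`/`exp_I_smul_Bint` (`= exp iB_b` inside the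
   domain of `log`) now sit on CERTIFIED middle members — `eq131_crossing_expIB` (`= exp iB_b`, `B_b = B8Thm2LogB.Bcross …`).
§6 (v1.1, APPEND-ONLY, same unit and generation) the MIRRORED crossing bonds `b₋ ∈ Λ_j`, `b₊ ∈ Λ_{j−1}` (print's «e.g.»
   leaves them to the reader; abstractly `B8Ineq145.LevelData.crossing_mirrored`): `I_smul_crossSum`, `eq130_crossing_mirrored`
   (`Ũ′_b = (U̿₁)_b·[R̄_{0,b}(\overline{R̄_{0,b₊}U̿₁})]⁻¹`), `eq131_crossing_mirrored` (= the argument of `log` in `B8Thm2LogB.BcrossMirror`,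
   literally), `eq131_crossing_mirrored_expIB`; v1 declarations byte-identical.
§7 (v1.2, APPEND-ONLY) THEOREM 2's LINE (1.36)–(1.37) «Q_j(U₀, ηA) = B on Λ_j, B given by (1.31) with V′ = Ũ′ʲ, |B| < 2dLα₁ by
   the assumption (1.35)» ON THE CERTIFIED AVERAGES (no prescribed `V`): `eq137_interior`, `eq137_crossing` — `exp iB_b = (Ū₁ʲ)_b`
   AND `|B_b| < 2dLα₁` from (87) at the sites, `U1`-valued averages and (1.35) (`B8Thm2LogB.ineq137_interior`/`ineq137_of_ineq135`
   supply the bound and the domain-of-`log` smallness; §4–§5 the identification); v1.1 declarations byte-identical.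
HONEST SCOPE.  (i) Everything is an identity of the lineage's formal objects (series logarithm `MatrixLog.mlog`, units of a
complete normed `ℂ`-algebra; no smallness is needed for the identities themselves — smallness enters only `exp iB_b = …`,
which stays in `B8Thm2LogB`).  (ii) The admissibility geometry (1.3)–(1.6) (that `B(b₋) ⊂ Λ_{j−1}` for a crossing bond, that
the tower under `y ∈ Λ_j` carries the conditions (1.19)) is NOT derived here: it is exactly what the hypotheses ask, site-
and block-wise, and §3 shows the typed classes `InAx`/`Restr129` deliver the site hypotheses.  (iii) `L ≥ 1` is assumed where
a block must contain its corner.  (iv) Nothing here is progress on `Summit.QuantumFields`; the value is that row B8.Eq1.31's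
derivation is now kernel-checked on the `ℤᵈ` carriers and `B8Thm2LogB`'s (1.37) bound applies to certified quantities.

[cite: Balaban1985RegularSpaces, (1.29)–(1.31) pp.81–82, (1.13) p.78, (1.17) p.78, (1.19)–(1.20) p.79; Balaban1985Averaging,
(55) p.27, (58) p.27, (67) p.29, (69)–(71) p.29, (78)–(80) p.30, (84)–(88) pp.30–31, (92) p.31, (97) p.32, (99) p.32, (105) p.33]
-/

noncomputable section

open NormedSpace Finset

namespace Literature.MathematicalPhysics.QuantumFieldTheory.Balaban1983to89.B8Eq131Derivation

open B7Prop1Explicit B7Prop2Explicit MatrixLog B7Eq92Concrete B7Eq99Concrete B7Eq84Concrete B7AvgGaugeCovariance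
open B7Eq106Concrete (mgauge_mgauge)
open B7Prop1Local (InBox AgreeOn hol_treeWord_congr)
open B8Ineq130 (inBox_of_le)
open B8Ineq132 (Under)
open B8Lemma1NonAbelian (covProd pert mulCfg hol_mulCfg_eq_covProd_mul boxVec_nonneg)
open B8Eq119TwistedAxial (Restr129 InAx mulCfg_eq_mul treeWord_boxVec_forward restr129_level_zero)
open B8Eq178Averages (restr129_iff_uavg)
open B8Thm2LogB (blockTop boxVec_le_blockTop crossSum crossMid neg_I_smul_crossSum Bint Bcross BcrossMirror
  exp_I_smul_Bint exp_I_smul_Bcross)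

-- `Site` alone would resolve to the torus sites of `Setup.lean`; re-export the `ℤ^d` sites of `B7Prop1Explicit`.
export B7Prop1Explicit (Site)

variable {d : ℕ}

/-! ## §0 Geometry of the tower `B8Ineq132.Under` ("`z ∈ Bᵐ(x)`") -/

/-- `Under L 0 x z ↔ z = x` (depth `0`: the site itself). [cite: Balaban1985RegularSpaces, p.79 ("x₀ ∈ Bʲ(x_j)")] -/
theorem under_zero_iff (L : ℕ) (x z : Site d) : Under L 0 x z ↔ z = x := by
  constructor
  · intro h
    funext i
    have hi := h i
    simp only [pow_zero, one_mul] at hi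
    omega
  · rintro rfl i
    simp only [pow_zero, one_mul]
    omega

/-- The block points `L•y + r`, `r ∈ [0, L)ᵈ`, lie one level under `y`. [cite: Balaban1985RegularSpaces, p.79 ("x_n ∈ B(x_{n+1})")] -/
theorem under_one_block (L : ℕ) (y : Site d) (r : Fin d → Fin L) : Under L 1 y ((L : ℤ) • y + boxVec L r) := by
  intro i
  have hr : ((r i : ℕ) : ℤ) + 1 ≤ (L : ℤ) := by exact_mod_cast (r i).isLt
  have hr0 : (0 : ℤ) ≤ ((r i : ℕ) : ℤ) := by positivity
  simp only [Pi.add_apply, Pi.smul_apply, smul_eq_mul, boxVec, pow_one]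
  constructor <;> nlinarith

/-- The corner `L•y` lies one level under `y` (`L ≥ 1`). [cite: Balaban1985RegularSpaces, p.79 ("x_n ∈ B(x_{n+1})")] -/
theorem under_one_corner {L : ℕ} (hL : 1 ≤ L) (y : Site d) : Under L 1 y ((L : ℤ) • y) := by
  intro i
  have hL' : (1 : ℤ) ≤ (L : ℤ) := by exact_mod_cast hL
  simp only [Pi.smul_apply, smul_eq_mul, pow_one]
  constructor <;> nlinarith

/-- Composition of depths: `z ∈ Bᵐ(x)`, `x ∈ B(y)` ⇒ `z ∈ B^{m+1}(y)`. [cite: Balaban1985RegularSpaces, p.79 ("x_n ∈ B(x_{n+1}), n = 0, 1, …, j − 1")] -/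
theorem under_succ_of_under_block {L m : ℕ} {y x z : Site d} (hx : Under L 1 y x) (hz : Under L m x z) :
    Under L (m + 1) y z := by
  intro i
  obtain ⟨h1, h2⟩ := hx i
  obtain ⟨h3, h4⟩ := hz i
  rw [pow_one] at h1 h2
  have hL : (0 : ℤ) ≤ (L : ℤ) ^ m := by positivity
  constructor
  · calc (L : ℤ) ^ (m + 1) * y i = (L : ℤ) ^ m * ((L : ℤ) * y i) := by ring
      _ ≤ (L : ℤ) ^ m * x i := mul_le_mul_of_nonneg_left h1 hL
      _ ≤ z i := h3
  · calc z i + 1 ≤ (L : ℤ) ^ m * (x i + 1) := h4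
      _ ≤ (L : ℤ) ^ m * ((L : ℤ) * (y i + 1)) := mul_le_mul_of_nonneg_left h2 hL
      _ = (L : ℤ) ^ (m + 1) * (y i + 1) := by ring

/-- The corner and the block points lie in the block box `[L•y, L•y + (L−1)𝟙]` (`B8Thm2LogB.blockTop`).
[cite: Balaban1985RegularSpaces, p.82 ("All sites of the contours Γ_{b₋,x} belong to Λ_{j−1}")] -/
theorem inBox_block (L : ℕ) (y : Site d) (r : Fin d → Fin L) :
    InBox ((L : ℤ) • y) ((L : ℤ) • y + blockTop L) ((L : ℤ) • y + boxVec L r) :=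
  inBox_of_le (le_add_of_nonneg_right (boxVec_nonneg L r)) (add_le_add_right (boxVec_le_blockTop L r) _)

/-- The corner lies in the block box (`L ≥ 1`). [cite: Balaban1985RegularSpaces, p.82 ("All sites of the contours Γ_{b₋,x} belong to Λ_{j−1}")] -/
theorem inBox_corner {L : ℕ} (hL : 1 ≤ L) (y : Site d) :
    InBox ((L : ℤ) • y) ((L : ℤ) • y + blockTop L) ((L : ℤ) • y) := by
  refine inBox_of_le le_rfl (le_add_of_nonneg_right fun i => ?_)
  have hL' : (1 : ℤ) ≤ (L : ℤ) := by exact_mod_cast hL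
  show (0 : ℤ) ≤ (L : ℤ) - 1
  omega

/-! ## §1 Dictionary: B8's (1.17), (1.19), (1.20) in the vocabulary of [3] (55), (58), (67), (69) -/

section Dictionary

variable {G : Type*} [Group G]

/-- **(1.17) IS (55) of [3]**: the transformation law `U′ᵘ(x, x′) = u(x)U′(x, x′)R(U₀(x, x′))u⁻¹(x′)` of the relative
variables (`B8Eq119TwistedAxial.eq117`: `U′ᵘ = (U′U₀)ᵘU₀⁻¹`) is the moving-frame action `B7Eq92Concrete.mgauge U₀ u U′`.
[cite: Balaban1985RegularSpaces, (1.17) p.78; Balaban1985Averaging, (55) p.27] -/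
theorem eq117_eq_mgauge (u : Site d → G) (U' U₀ : Site d → Fin d → G) :
    pert (gaugeAct u (mulCfg U' U₀)) U₀ = mgauge U₀ u U' := by
  funext x μ
  simp only [pert, gaugeAct, mulCfg, mgauge_apply, Rc_apply, mul_inv_rev, inv_inv, mul_assoc]

/-- `U₁ = U′^{u⁻¹}` for `U′ = U₁ᵘ` (p. 81: *"U′^{u⁻¹} = U₁"*): the action (55)/(1.17) is a group action
(`B7Eq106Concrete.mgauge_mgauge`). [cite: Balaban1985RegularSpaces, p.81 ("U′^{u⁻¹} = U₁"); Balaban1985Averaging, (55) p.27] -/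
theorem mgauge_inv_mgauge (U₀ : Site d → Fin d → G) (u : Site d → G) (U₁ : Site d → Fin d → G) :
    mgauge U₀ u⁻¹ (mgauge U₀ u U₁) = U₁ := by
  rw [mgauge_mgauge, inv_mul_cancel]
  funext x κ
  simp

/-- **The (1.19)-product IS the twisted transport (58) of [3]** on contours of positively oriented bonds:
`∏_{b⊂Γ} R(V₀(Γ_{x,b₋}))V′_b` (`B8Lemma1NonAbelian.covProd`) `= (V′V₀)(Γ)V₀(Γ)⁻¹` (`B7Eq92Concrete.tHol`).
[cite: Balaban1985RegularSpaces, (1.19) p.79; Balaban1985Averaging, (58) p.27] -/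
theorem covProd_eq_tHol (V₀ V' : Site d → Fin d → G) (x : Site d) (w : List (Letter d))
    (hw : ∀ l ∈ w, l = (l.1, true)) : covProd V₀ V' x w = tHol V₀ V' x w := by
  rw [tHol, ← mulCfg_eq_mul, hol_mulCfg_eq_covProd_mul V₀ V' x w hw, mul_inv_cancel_right]

/-- Locality of the twisted transport (58) along a block contour: it sees the field only on the bonds of the block box
`[L•y, L•y + (L−1)𝟙]` (`B7Prop1Local.hol_treeWord_congr`).
[cite: Balaban1985Averaging, (58) p.27; Balaban1985RegularSpaces, p.82 ("All sites of the contours Γ_{b₋,x} belong to Λ_{j−1}")] -/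
theorem tHol_congr_of_agree (L : ℕ) (hL : 1 ≤ L) (V₀ W W' : Site d → Fin d → G) (y : Site d)
    (h : AgreeOn ((L : ℤ) • y) ((L : ℤ) • y + blockTop L) (W * V₀) (W' * V₀)) (r : Fin d → Fin L) :
    tHol V₀ W ((L : ℤ) • y) (treeWord (boxVec L r)) = tHol V₀ W' ((L : ℤ) • y) (treeWord (boxVec L r)) := by
  rw [tHol, tHol, hol_treeWord_congr h ((L : ℤ) • y) (boxVec L r) (inBox_corner hL y) (inBox_block L y r)]

end Dictionary

section Carriers

variable {𝔸 : Type*} [NormedRing 𝔸] [NormedAlgebra ℂ 𝔸] [CompleteSpace 𝔸]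

/-- **(1.20) IS (69) of [3]**: `Ũ′ⁿ = (\overline{U′U₀})ⁿ(Ū₀ⁿ)⁻¹` — b2b's `pert` of the averages (43) is b07's `tildIter`.
[cite: Balaban1985RegularSpaces, (1.20) p.79; Balaban1985Averaging, (69) p.29] -/
theorem pert_avgIter_eq_tildIter (L : ℕ) (U₀ U' : Site d → Fin d → 𝔸ˣ) (n : ℕ) :
    pert (avgIter L (U' * U₀) n) (avgIter L U₀ n) = tildIter L U₀ U' n := by
  funext z κ
  rfl

/-- **(1.19) at one block IS (67) of [3] there**: `(R̄ⁿ_{0,Lz}Ũ′ⁿ)(Γ_{Lz,Lz+r}) = 1` in the `covProd`/`pert` typing of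
`B8Eq119TwistedAxial.InAx` ⟺ the same in the `tHol`/`tildIter` typing of `B7Eq84Concrete.AxialGauge`.
[cite: Balaban1985RegularSpaces, (1.19) p.79; Balaban1985Averaging, (67) p.29] -/
theorem ax119_iff_ax67 (L : ℕ) (U₀ U' : Site d → Fin d → 𝔸ˣ) (n : ℕ) (z : Site d) (r : Fin d → Fin L) :
    covProd (avgIter L U₀ n) (pert (avgIter L (U' * U₀) n) (avgIter L U₀ n)) ((L : ℤ) • z) (treeWord (boxVec L r)) = 1
      ↔ tHol (avgIter L U₀ n) (tildIter L U₀ U' n) ((L : ℤ) • z) (treeWord (boxVec L r)) = 1 := by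
  rw [pert_avgIter_eq_tildIter, covProd_eq_tHol _ _ _ _ (treeWord_boxVec_forward L r)]

/-! ## §2 [3] (84) and (87) AT ONE SITE, from the axial conditions in the tower under it -/

/-- **(84) of [3], LOCALISED**: *"(\overline{R₀u}ʲ)(x_j) = u(x_j)\overline{R_{0,x_j}U₁}^{(j)}, x_j ∈ Ω^{(j)} (84)"* holds AT THE
SITE `y` of the level-`j` lattice as soon as `U′ = U₁ᵘ` satisfies the block axial gauge conditions (67) = (1.19) on every
block of the tower `Bʲ(y)` under `y` (levels `n < j`, corners `Lz` with `z ∈ B^{j−n−1}(y)`), `L ≥ 1` — print's induction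
(`B7Eq84Concrete.eq84`, which assumes (67) on the whole lattice), carried out under one site: the step `j → j + 1` uses the
hypothesis at the points of `B(y)` and (76) at the block `B(y)` itself (`B7Eq84Concrete.eq72_iff_eq76`), the
multiplicativity of `R` and the left-invariance of the site average (78) (`B7Eq99Concrete.savg_const_mul`).
[cite: Balaban1985Averaging, (84) p.30, (76) p.29, (78) p.30; Balaban1985RegularSpaces, (1.19) p.79, (1.29) p.81] -/
theorem eq84_local (L : ℕ) (hL : 1 ≤ L) (U₀ U₁ : Site d → Fin d → 𝔸ˣ) (u : Site d → 𝔸ˣ) :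
    ∀ (j : ℕ) (y : Site d),
      (∀ n, n < j → ∀ z : Site d, Under L (j - (n + 1)) y z → ∀ r : Fin d → Fin L,
        tHol (avgIter L U₀ n) (tildIter L U₀ (mgauge U₀ u U₁) n) ((L : ℤ) • z) (treeWord (boxVec L r)) = 1) →
      uavg L U₀ u j y = uLev L u j y * wrec L U₀ U₁ j y
  | 0, y, _ => by simp
  | j + 1, y, hax => by
    -- the hypothesis descends to every level-`j` site `x ∈ B(y)` (its tower lies in the tower of `y`)
    have hIH : ∀ x : Site d, Under L 1 y x → uavg L U₀ u j x = uLev L u j x * wrec L U₀ U₁ j x := by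
      intro x hx
      refine eq84_local L hL U₀ U₁ u j x fun n hn z hz r => hax n (Nat.lt_succ_of_lt hn) z ?_ r
      have e1 : j + 1 - (n + 1) = (j - (n + 1)) + 1 := by omega
      rw [e1]
      exact under_succ_of_under_block hx hz
    -- (76) on the block `B(y)` from the axial condition (67) at level `j`, corner `Ly` (`n = j`, `z = y`)
    have h76 : ∀ r : Fin d → Fin L,
        R0fun (avgIter L U₀ j) ((L : ℤ) • y) (uLev L u j) ((L : ℤ) • y + boxVec L r)
          = uLev L u j ((L : ℤ) • y)
            * tHol (avgIter L U₀ j) (tildIter L U₀ U₁ j) ((L : ℤ) • y) (treeWord (boxVec L r)) := by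
      intro r
      have h := hax j (Nat.lt_succ_self j) y (by rw [Nat.sub_self]; exact (under_zero_iff L y y).2 rfl) r
      rw [tildIter_mgauge] at h
      have h' := (eq72_iff_eq76 (avgIter L U₀ j) (tildIter L U₀ U₁ j) (uLev L u j) ((L : ℤ) • y)
        ((L : ℤ) • y + boxVec L r)).1
      rw [add_sub_cancel_left] at h'
      exact h' h
    rw [uavg_succ, R0avg, wrec_succ, ← uLev_smul L u j y, ← savg_const_mul]
    apply savg_congr
    · rw [R0fun_self, R0fun_self, sub_self, treeWord_zero, tHol_nil, one_mul]
      exact hIH _ (under_one_corner hL y)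
    · intro r
      have h76r := h76 r
      rw [R0fun_apply, add_sub_cancel_left] at h76r
      simp only [R0fun_apply, add_sub_cancel_left, hIH _ (under_one_block L y r), map_mul, h76r, mul_assoc]

/-- **(87) of [3] AT ONE SITE** (*"u(y) = (\overline{R_{0,y}U₁^{(k)}})⁻¹ (87)"*, print p. 31: (84) and the averaging condition
give *"(\overline{R₀u^k})(y) = u(y)\overline{R_{0,y}U₁^{(k)}} = 1 (86), hence (87)"*): (1.29) AT `y ∈ Λ_j` — `(\overline{R₀u}ʲ)(y) = 1`,
i.e. `uavg L U₀ u j y = 1` (`B8Eq178Averages.restr129_iff_uavg`) — together with the axial conditions (1.19) in the tower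
under `y` determines `u` at `y` *"in terms of the configuration U₁"* (B8 p. 81): `u_j(y) = w_j(y)⁻¹`, `w_j =
\overline{R_{0,·}U₁}^{(j)}` the block averages (85) (`B7Eq99Concrete.wrec`, `= v_j` (97) by (99) `wrec_eq_vcov`).
[cite: Balaban1985Averaging, (86)–(87) p.31, (84) p.30; Balaban1985RegularSpaces, (1.29) p.81, p.81 ("In [3] we have determined the gauge transformation u in terms of the configuration U₁")] -/
theorem eq87_local (L : ℕ) (hL : 1 ≤ L) (U₀ U₁ : Site d → Fin d → 𝔸ˣ) (u : Site d → 𝔸ˣ) (j : ℕ) (y : Site d)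
    (hax : ∀ n, n < j → ∀ z : Site d, Under L (j - (n + 1)) y z → ∀ r : Fin d → Fin L,
      tHol (avgIter L U₀ n) (tildIter L U₀ (mgauge U₀ u U₁) n) ((L : ℤ) • z) (treeWord (boxVec L r)) = 1)
    (h129 : uavg L U₀ u j y = 1) : uLev L u j y = (wrec L U₀ U₁ j y)⁻¹ := by
  rw [eq84_local L hL U₀ U₁ u j y hax, mul_eq_one_iff_eq_inv] at h129
  exact h129

/-! ## §3 (87) at every site of `𝔅_k` from the TYPED classes (1.19) `InAx` and (1.29) `Restr129` -/

/-- **p. 81 *"In [3] we have determined the gauge transformation u in terms of the configuration U₁"* for the typed classes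
of the tree**: if `U′U₀ ∈ Ax_k(𝔅_k, U₀)` in the sense of `B8Eq119TwistedAxial.InAx` ((1.19) in the towers under the sites of
`Λ_j`, `1 ≤ j ≤ k`), `U′ = U₁ᵘ` ((1.17)/(55)), and `u` satisfies (1.29) `B8Eq119TwistedAxial.Restr129` (`(\overline{R₀u}ʲ)(y) = 1`,
`y ∈ Λ_j`, `j ≤ k`), then (87) of [3] holds at every `y ∈ Λ_j`, `j ≤ k`: `u_j(y) = (\overline{R_{0,y}U₁}^{(j)})⁻¹` (at `j = 0`:
`u(y) = 1`, (1.14)). [cite: Balaban1985RegularSpaces, (1.29) p.81, (1.19) p.79, (1.14) p.78; Balaban1985Averaging, (87) p.31] -/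
theorem eq87_of_inAx_restr129 (L : ℕ) (hL : 1 ≤ L) (k : ℕ) (Λ : ℕ → Set (Site d))
    (U₀ U₁ : Site d → Fin d → 𝔸ˣ) (u : Site d → 𝔸ˣ)
    (hAx : InAx L k Λ U₀ (mgauge U₀ u U₁ * U₀)) (h129 : Restr129 L k Λ U₀ u) :
    ∀ j, j ≤ k → ∀ y ∈ Λ j, uLev L u j y = (wrec L U₀ U₁ j y)⁻¹ := by
  intro j hjk y hy
  rw [restr129_iff_uavg] at h129
  refine eq87_local L hL U₀ U₁ u j y (fun n hn z hz r => ?_) (h129 j hjk y hy)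
  have h1 : 1 ≤ j := by omega
  exact (ax119_iff_ax67 L U₀ (mgauge U₀ u U₁) n z r).1 (hAx j h1 hjk y hy n hn z hz r)

/-! ## §4 (1.30) and the first line of (1.31): interior bonds `b₋, b₊ ∈ Λ_j` -/

/-- **(1.30), first equality** *"(Ũ₁^{u j})_b = u(b₋)(Ũ₁ʲ)_b R̄ʲ_{0,b} u⁻¹(b₊)"* — (70)/(71) of [3] for `U′ = U₁ᵘ`, `b = ⟨y, y + e_κ⟩` a
level-`j` bond, `R̄ʲ_{0,b} = R(Ū₀ʲ(b))` (a pointer to `B7Eq92Concrete.tildIter_mgauge`).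
[cite: Balaban1985RegularSpaces, (1.30) p.81; Balaban1985Averaging, (70)–(71) p.29] -/
theorem eq130_lhs (L : ℕ) (U₀ U₁ : Site d → Fin d → 𝔸ˣ) (u : Site d → 𝔸ˣ) (j : ℕ) (y : Site d) (κ : Fin d) :
    tildIter L U₀ (mgauge U₀ u U₁) j y κ
      = uLev L u j y * tildIter L U₀ U₁ j y κ * (Rc (avgIter L U₀ j y κ) (uLev L u j (y + e κ)))⁻¹ := by
  rw [tildIter_mgauge, mgauge_apply]

/-- **p. 81: *"If both end-points b₋, b₊ of a bond b belong to Λ_j, then the expression on the left-hand side of (1.30) is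
equal to (Ū₁ʲ)_b by (92) of [3]"*** — with (87) at `b₋` and at `b₊` (§2–§3), `Ũ′ʲ_b = u(b₋)(Ũ₁ʲ)_b R̄ʲ_{0,b} u⁻¹(b₊) =
w_j(b₋)⁻¹(Ũ₁ʲ)_b R̄ʲ_{0,b} w_j(b₊) = (U̿₁ʲ)_b`, the last step the fundamental equality (92) `B7Eq99Concrete.eq92` (print's single
bar `Ū₁ʲ` = [3]'s `U̿₁ʲ` = `dbavgCovIter`, READING (a)). [cite: Balaban1985RegularSpaces, (1.30) p.81; Balaban1985Averaging, (92) p.31, (87)–(88) p.31] -/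
theorem eq130_interior (L : ℕ) (U₀ U₁ : Site d → Fin d → 𝔸ˣ) (u : Site d → 𝔸ˣ) (j : ℕ) (y : Site d) (κ : Fin d)
    (hm : uLev L u j y = (wrec L U₀ U₁ j y)⁻¹) (hp : uLev L u j (y + e κ) = (wrec L U₀ U₁ j (y + e κ))⁻¹) :
    tildIter L U₀ (mgauge U₀ u U₁) j y κ = dbavgCovIter L U₀ U₁ j y κ := by
  rw [tildIter_mgauge, mgauge_apply, hm, hp, map_inv, inv_inv, ← eq92 L U₀ U₁ j y κ]

/-- **(1.31), FIRST LINE** *"(Ū₁ʲ)_b = V′_b, if b ⊂ Λ_j (i.e., b₋, b₊ ∈ Λ_j)"*, `V′ = V(Ū₀ʲ)⁻¹`: by `eq130_interior` and the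
membership (1.13)/(1.30) `(\overline{U′U₀})ʲ_b = V_b` at the bond. [cite: Balaban1985RegularSpaces, (1.31) p.82, (1.30) p.81, (1.13) p.78] -/
theorem eq131_interior (L : ℕ) (U₀ U₁ : Site d → Fin d → 𝔸ˣ) (u : Site d → 𝔸ˣ) (j : ℕ) (y : Site d) (κ : Fin d)
    (hm : uLev L u j y = (wrec L U₀ U₁ j y)⁻¹) (hp : uLev L u j (y + e κ) = (wrec L U₀ U₁ j (y + e κ))⁻¹)
    (V : Site d → Fin d → 𝔸ˣ) (h13 : avgIter L (mgauge U₀ u U₁ * U₀) j y κ = V y κ) :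
    dbavgCovIter L U₀ U₁ j y κ = V y κ * (avgIter L U₀ j y κ)⁻¹ := by
  rw [← eq130_interior L U₀ U₁ u j y κ hm hp, tildIter_apply, h13]

/-- **(1.31), first line, complete**: *"(Ū₁ʲ)_b = V′_b = exp iB_b, if b ⊂ Λ_j"* — with `B_b = (1/i) log V′_b`
(`B8Thm2LogB.Bint`) inside the domain `|V′_b − 1| < 1` of the series logarithm (`B8Thm2LogB.exp_I_smul_Bint`).
[cite: Balaban1985RegularSpaces, (1.31) p.82] -/
theorem eq131_interior_expIB (L : ℕ) (U₀ U₁ : Site d → Fin d → 𝔸ˣ) (u : Site d → 𝔸ˣ) (j : ℕ) (y : Site d)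
    (κ : Fin d) (hm : uLev L u j y = (wrec L U₀ U₁ j y)⁻¹) (hp : uLev L u j (y + e κ) = (wrec L U₀ U₁ j (y + e κ))⁻¹)
    (V : Site d → Fin d → 𝔸ˣ) (h13 : avgIter L (mgauge U₀ u U₁ * U₀) j y κ = V y κ)
    (hsmall : ‖((V y κ * (avgIter L U₀ j y κ)⁻¹ : 𝔸ˣ) : 𝔸) - 1‖ < 1) :
    ((dbavgCovIter L U₀ U₁ j y κ : 𝔸ˣ) : 𝔸) = exp (Complex.I • Bint (V y κ * (avgIter L U₀ j y κ)⁻¹)) := by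
  rw [eq131_interior L U₀ U₁ u j y κ hm hp V h13, exp_I_smul_Bint hsmall]

/-! ## §5 The crossing bonds `b₋ ∈ Λ_{j−1}`, `b₊ ∈ Λ_j` (stated one level up: `j ↦ j + 1`) -/

/-- **p. 81: *"In this case the formulas (97), (99), and (87) of [3] imply (Ũ₁^{u j})_b = \overline{R̄^{j−1}_{0,b₋}Ū₁^{j−1}}(Ū₁ʲ)_b"***
— for a level-`(j+1)` bond `b = ⟨y, y + e_κ⟩` with (87) at `b₊` (level `j + 1`) and at `b₋` READ ONE LEVEL DOWN (the corner
`L•y`, a `Λ_j`-site): `u(b₋) = w_j(L•y)⁻¹ = \overline{R̄ʲ_{0,b₋}U̿₁ʲ}·w_{j+1}(y)⁻¹` by (97)/(99) (`vcov_succ`, `wrec_eq_vcov`), and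
then (92): `Ũ′^{j+1}_b = \overline{R̄ʲ_{0,b₋}U̿₁ʲ}·(U̿₁^{j+1})_b`, the factor being the block frame (82) `B7Eq92Concrete.wframe` of
`U̿₁ʲ` at `Ū₀ʲ`. [cite: Balaban1985RegularSpaces, (1.30)–(1.31) pp.81–82; Balaban1985Averaging, (97) p.32, (99) p.32, (87) p.31, (92) p.31] -/
theorem eq130_crossing (L : ℕ) (U₀ U₁ : Site d → Fin d → 𝔸ˣ) (u : Site d → 𝔸ˣ) (j : ℕ) (y : Site d) (κ : Fin d)
    (hm : uLev L u j ((L : ℤ) • y) = (wrec L U₀ U₁ j ((L : ℤ) • y))⁻¹)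
    (hp : uLev L u (j + 1) (y + e κ) = (wrec L U₀ U₁ (j + 1) (y + e κ))⁻¹) :
    tildIter L U₀ (mgauge U₀ u U₁) (j + 1) y κ
      = wframe L (avgIter L U₀ j) (dbavgCovIter L U₀ U₁ j) ((L : ℤ) • y) * dbavgCovIter L U₀ U₁ (j + 1) y κ := by
  rw [tildIter_mgauge, mgauge_apply, ← uLev_smul L u j y, hm, hp, map_inv, inv_inv, ← eq92 L U₀ U₁ (j + 1) y κ,
    wrec_eq_vcov L U₀ U₁ j, wrec_eq_vcov L U₀ U₁ (j + 1), vcov_succ L U₀ U₁ j y]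
  group

/-- **(105) of [3]** for that factor: *"\overline{R̄^{j−1}_{0,b₋}Ū₁^{j−1}} = exp[i Σ_{x∈B(b₋)} L^{−d} (1/i) log(R̄^{j−1}_{0,b₋}Ū₁^{j−1})(Γ_{b₋,x})]"*
(`i·(1/i) = 1`; the block points `x = L•y + r`, `log` = the series `MatrixLog.mlog`; cf. `B7Eq106Concrete.eq105`).
[cite: Balaban1985RegularSpaces, p.81 (display after (1.30)); Balaban1985Averaging, (105) p.33, (82) p.30] -/
theorem eq105_wframe (L : ℕ) (V₀ W : Site d → Fin d → 𝔸ˣ) (q : Site d) :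
    ((wframe L V₀ W q : 𝔸ˣ) : 𝔸)
      = exp (∑ r : Fin d → Fin L, (((L : ℝ) ^ d)⁻¹)
          • mlog ((tHol V₀ W q (treeWord (boxVec L r)) : 𝔸ˣ) : 𝔸)) := rfl

/-- **p. 82: *"All sites of the contours Γ_{b₋,x} belong to Λ_{j−1}, hence Ū₁^{j−1} in the above formula is equal to
V(Ū₀^{j−1})⁻¹"*** — on the block `B(b₋) = [L•y, L•y + (L−1)𝟙]` of level-`j` sites: (87) at its sites and (1.13) on its bonds
give, by `eq131_interior` bond by bond, `U̿₁ʲŪ₀ʲ = V` there (`B7Prop1Local.AgreeOn`).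
[cite: Balaban1985RegularSpaces, (1.31) p.82, (1.13) p.78; Balaban1985Averaging, (92) p.31] -/
theorem dbavg_agree_of_block (L : ℕ) (U₀ U₁ : Site d → Fin d → 𝔸ˣ) (u : Site d → 𝔸ˣ) (j : ℕ) (y : Site d)
    (V : Site d → Fin d → 𝔸ˣ)
    (h87 : ∀ x : Site d, InBox ((L : ℤ) • y) ((L : ℤ) • y + blockTop L) x → uLev L u j x = (wrec L U₀ U₁ j x)⁻¹)
    (h13 : AgreeOn ((L : ℤ) • y) ((L : ℤ) • y + blockTop L) (avgIter L (mgauge U₀ u U₁ * U₀) j) V) :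
    AgreeOn ((L : ℤ) • y) ((L : ℤ) • y + blockTop L) (dbavgCovIter L U₀ U₁ j * avgIter L U₀ j) V := by
  intro x κ hx hxκ
  simp only [Pi.mul_apply]
  rw [eq131_interior L U₀ U₁ u j x κ (h87 x hx) (h87 _ hxκ) V (h13 x κ hx hxκ), inv_mul_cancel_right]

/-- **(1.31), SECOND LINE** *"(Ū₁ʲ)_b = exp[−i Σ_{x∈B(b₋)} L^{−d} (1/i) log(R̄^{j−1}_{0,b₋}V′)(Γ_{b₋,x})] V′_b, if b₋ ∈ Λ_{j−1},
b₊ ∈ Λ_j"* IN THE VOCABULARY OF `B8Thm2LogB`** (`crossMid L V₀ V′ q w = exp[−i·crossSum] w`, `crossSum` built on the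
(1.19)-product `covProd`): for a level-`(j+1)` bond `b = ⟨y, y + e_κ⟩` with (87) at `b₊`, (87) and (1.13) on the block `B(b₋)`
of level-`j` sites (*"All sites of the contours Γ_{b₋,x} belong to Λ_{j−1}"*), and (1.13) at `b` (`(\overline{U′U₀})^{j+1}_b = V_b`),
`(U̿₁^{j+1})_b = crossMid L Ū₀ʲ V′ⱼ (L•y) V′_b` with `V′ⱼ = V_j(Ū₀ʲ)⁻¹` (`pert`), `V′_b = V_b(Ū₀^{j+1})_b⁻¹`.  Assembly of
`eq130_crossing` (the factor), `eq105_wframe`/(105) (its exponential form, inverted: `B8Thm2LogB.neg_I_smul_crossSum`),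
`dbavg_agree_of_block` + `tHol_congr_of_agree` (`U̿₁ʲ ↦ V′ⱼ` inside the exponent) and `covProd_eq_tHol` ((1.19)-product =
(58)).  With `B8Thm2LogB.exp_I_smul_Bcross` this is `= exp iB_b` inside the domain of `log`.
[cite: Balaban1985RegularSpaces, (1.31) p.82, (1.30) p.81, (1.13) p.78; Balaban1985Averaging, (105) p.33, (92) p.31, (97) p.32, (99) p.32, (87) p.31] -/
theorem eq131_crossing (L : ℕ) (hL : 1 ≤ L) (U₀ U₁ : Site d → Fin d → 𝔸ˣ) (u : Site d → 𝔸ˣ) (j : ℕ) (y : Site d)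
    (κ : Fin d) (Vj V : Site d → Fin d → 𝔸ˣ)
    (h87 : ∀ x : Site d, InBox ((L : ℤ) • y) ((L : ℤ) • y + blockTop L) x → uLev L u j x = (wrec L U₀ U₁ j x)⁻¹)
    (h13j : AgreeOn ((L : ℤ) • y) ((L : ℤ) • y + blockTop L) (avgIter L (mgauge U₀ u U₁ * U₀) j) Vj)
    (hp : uLev L u (j + 1) (y + e κ) = (wrec L U₀ U₁ (j + 1) (y + e κ))⁻¹)
    (h13 : avgIter L (mgauge U₀ u U₁ * U₀) (j + 1) y κ = V y κ) :
    ((dbavgCovIter L U₀ U₁ (j + 1) y κ : 𝔸ˣ) : 𝔸)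
      = crossMid L (avgIter L U₀ j) (pert Vj (avgIter L U₀ j)) ((L : ℤ) • y)
          (V y κ * (avgIter L U₀ (j + 1) y κ)⁻¹) := by
  -- (1.30) on the crossing bond: `Ũ′_b = F·(U̿₁)_b`, `F` the block frame (82) of `U̿₁ʲ` at `Ū₀ʲ`; `Ũ′_b = V′_b` by (1.13)
  have h130 := eq130_crossing L U₀ U₁ u j y κ (h87 _ (inBox_corner hL y)) hp
  rw [tildIter_apply, h13] at h130
  have hsol : dbavgCovIter L U₀ U₁ (j + 1) y κ
      = (wframe L (avgIter L U₀ j) (dbavgCovIter L U₀ U₁ j) ((L : ℤ) • y))⁻¹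
          * (V y κ * (avgIter L U₀ (j + 1) y κ)⁻¹) := by
    rw [h130, inv_mul_cancel_left]
  -- inside the exponent: `U̿₁ʲŪ₀ʲ = V_j` on the block (p. 82, first sentence), and the (1.19)-product is (58)
  have hpert : pert Vj (avgIter L U₀ j) * avgIter L U₀ j = Vj := by
    funext x μ
    simp only [Pi.mul_apply, pert, inv_mul_cancel_right]
  have hagree : AgreeOn ((L : ℤ) • y) ((L : ℤ) • y + blockTop L)
      (dbavgCovIter L U₀ U₁ j * avgIter L U₀ j) (pert Vj (avgIter L U₀ j) * avgIter L U₀ j) := by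
    rw [hpert]
    exact dbavg_agree_of_block L U₀ U₁ u j y Vj h87 h13j
  have hF : Fcov L (avgIter L U₀ j) (dbavgCovIter L U₀ U₁ j) ((L : ℤ) • y)
      = ∑ r : Fin d → Fin L, (((L : ℝ) ^ d)⁻¹) •
          mlog ((covProd (avgIter L U₀ j) (pert Vj (avgIter L U₀ j)) ((L : ℤ) • y) (treeWord (boxVec L r)) : 𝔸ˣ) : 𝔸) := by
    unfold Fcov
    refine Finset.sum_congr rfl fun r _ => ?_
    rw [tHol_congr_of_agree L hL _ _ _ y hagree r, covProd_eq_tHol _ _ _ _ (treeWord_boxVec_forward L r)]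
  rw [hsol, Units.val_mul, wframe, val_inv_expUnit, val_expUnit, hF, crossMid, neg_I_smul_crossSum]


/-- **(1.31), second line, complete**: *"(Ū₁ʲ)_b = exp[−i Σ …] V′_b = exp iB_b, if b₋ ∈ Λ_{j−1}, b₊ ∈ Λ_j"* — with
`B_b = (1/i) log(exp[−i Σ …] V′_b)` (`B8Thm2LogB.Bcross`) inside the domain of the series logarithm
(`B8Thm2LogB.exp_I_smul_Bcross`; the smallness that puts it there is `B8Thm2LogB.ineq137_crossing`'s business).
[cite: Balaban1985RegularSpaces, (1.31) p.82] -/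
theorem eq131_crossing_expIB (L : ℕ) (hL : 1 ≤ L) (U₀ U₁ : Site d → Fin d → 𝔸ˣ) (u : Site d → 𝔸ˣ) (j : ℕ)
    (y : Site d) (κ : Fin d) (Vj V : Site d → Fin d → 𝔸ˣ)
    (h87 : ∀ x : Site d, InBox ((L : ℤ) • y) ((L : ℤ) • y + blockTop L) x → uLev L u j x = (wrec L U₀ U₁ j x)⁻¹)
    (h13j : AgreeOn ((L : ℤ) • y) ((L : ℤ) • y + blockTop L) (avgIter L (mgauge U₀ u U₁ * U₀) j) Vj)
    (hp : uLev L u (j + 1) (y + e κ) = (wrec L U₀ U₁ (j + 1) (y + e κ))⁻¹)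
    (h13 : avgIter L (mgauge U₀ u U₁ * U₀) (j + 1) y κ = V y κ)
    (hsmall : ‖crossMid L (avgIter L U₀ j) (pert Vj (avgIter L U₀ j)) ((L : ℤ) • y)
        (V y κ * (avgIter L U₀ (j + 1) y κ)⁻¹) - 1‖ < 1) :
    ((dbavgCovIter L U₀ U₁ (j + 1) y κ : 𝔸ˣ) : 𝔸)
      = exp (Complex.I • Bcross L (avgIter L U₀ j) (pert Vj (avgIter L U₀ j)) ((L : ℤ) • y)
          (V y κ * (avgIter L U₀ (j + 1) y κ)⁻¹)) := by
  rw [eq131_crossing L hL U₀ U₁ u j y κ Vj V h87 h13j hp h13, exp_I_smul_Bcross L _ _ _ hsmall]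


/-! ## §6 (v1.1) The MIRRORED crossing bonds `b₋ ∈ Λ_j`, `b₊ ∈ Λ_{j−1}` — print's «e.g.» leaves this orientation to the
reader; `B8Ineq145.LevelData.crossing_mirrored` (abstract carriers) and `B8Thm2LogB.BcrossMirror`/`ineq137_crossing_mirrored`
treat it; here on the `ℤᵈ` carriers, stated one level up as in §5 -/

omit [CompleteSpace 𝔸] in
/-- `i · Σ_x L^{−d} (1/i) log P_x = Σ_x L^{−d} log P_x`: the exponent of `B8Thm2LogB.BcrossMirror` is the block exp-mean-log
(105) of [3] itself (companion of `B8Thm2LogB.neg_I_smul_crossSum`). [cite: Balaban1985RegularSpaces, (1.31) p.82; Balaban1985Averaging, (105) p.33] -/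
theorem I_smul_crossSum (L : ℕ) (V₀ V' : Site d → Fin d → 𝔸ˣ) (q : Site d) :
    Complex.I • crossSum L V₀ V' q
      = ∑ r : Fin d → Fin L, (((L : ℝ) ^ d)⁻¹)
          • mlog ((covProd V₀ V' q (treeWord (boxVec L r)) : 𝔸ˣ) : 𝔸) := by
  rw [crossSum, Finset.smul_sum]
  refine Finset.sum_congr rfl fun r _ => ?_
  rw [smul_comm, smul_smul, mul_inv_cancel₀ Complex.I_ne_zero, one_smul]

/-- **(1.30) on a MIRRORED crossing bond** (`b₋ ∈ Λ_j`, `b₊ ∈ Λ_{j−1}`, the orientation print's «e.g.» leaves to the reader):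
for a level-`(j+1)` bond `b = ⟨y, y + e_κ⟩` with (87) at `b₋` (level `j + 1`) and at `b₊` READ ONE LEVEL DOWN (the corner
`L•(y + e_κ)`): `Ũ′^{j+1}_b = (U̿₁^{j+1})_b · [R̄^{j+1}_{0,b}(\overline{R̄ʲ_{0,b₊}U̿₁ʲ})]⁻¹` — the block frame now sits at `b₊`,
rotated by `R̄_{0,b} = R(Ū₀^{j+1}(b))` ((97)/(99)/(87) and (92), as in `eq130_crossing`; the abstract law is
`B8Ineq145.LevelData.crossing_mirrored`). [cite: Balaban1985RegularSpaces, (1.30)–(1.31) pp.81–82; Balaban1985Averaging, (97) p.32, (99) p.32, (87) p.31, (92) p.31] -/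
theorem eq130_crossing_mirrored (L : ℕ) (U₀ U₁ : Site d → Fin d → 𝔸ˣ) (u : Site d → 𝔸ˣ) (j : ℕ) (y : Site d)
    (κ : Fin d) (hm : uLev L u (j + 1) y = (wrec L U₀ U₁ (j + 1) y)⁻¹)
    (hp : uLev L u j ((L : ℤ) • (y + e κ)) = (wrec L U₀ U₁ j ((L : ℤ) • (y + e κ)))⁻¹) :
    tildIter L U₀ (mgauge U₀ u U₁) (j + 1) y κ
      = dbavgCovIter L U₀ U₁ (j + 1) y κ
          * (Rc (avgIter L U₀ (j + 1) y κ)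
              (wframe L (avgIter L U₀ j) (dbavgCovIter L U₀ U₁ j) ((L : ℤ) • (y + e κ))))⁻¹ := by
  rw [tildIter_mgauge, mgauge_apply, ← uLev_smul L u j (y + e κ), hm, hp, ← eq92 L U₀ U₁ (j + 1) y κ,
    wrec_eq_vcov L U₀ U₁ j, wrec_eq_vcov L U₀ U₁ (j + 1), vcov_succ L U₀ U₁ j (y + e κ)]
  simp only [map_mul, map_inv, inv_inv]
  group

/-- **(1.31), second line, MIRRORED** in the vocabulary of `B8Thm2LogB.BcrossMirror` (`B_b = (1/i) log(V′_b · R(g) exp[+i Σ_{B(b₊)} …])`,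
`g = Ū₀(b)`): for a level-`(j+1)` bond `b = ⟨y, y + e_κ⟩` with (87) at `b₋`, (87) and (1.13) on the block `B(b₊)` of level-`j`
sites, and (1.13) at `b`: `(U̿₁^{j+1})_b = V′_b · (g · exp[i·crossSum L Ū₀ʲ V′ⱼ (L•b₊)] · g⁻¹)`, `V′_b = V_b g⁻¹`, `g = Ū₀^{j+1}(b)`,
`V′ⱼ = V_j(Ū₀ʲ)⁻¹` — the argument of `log` in `BcrossMirror L Ū₀ʲ V′ⱼ (L•b₊) g V′_b`. Assembly as in `eq131_crossing`
(`eq130_crossing_mirrored`, (105) `eq105_wframe`, `dbavg_agree_of_block` + `tHol_congr_of_agree` at the block of `b₊`,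
`covProd_eq_tHol`, `I_smul_crossSum`). [cite: Balaban1985RegularSpaces, (1.31) p.82, (1.13) p.78; Balaban1985Averaging, (105) p.33, (92) p.31] -/
theorem eq131_crossing_mirrored (L : ℕ) (hL : 1 ≤ L) (U₀ U₁ : Site d → Fin d → 𝔸ˣ) (u : Site d → 𝔸ˣ) (j : ℕ)
    (y : Site d) (κ : Fin d) (Vj V : Site d → Fin d → 𝔸ˣ)
    (hm : uLev L u (j + 1) y = (wrec L U₀ U₁ (j + 1) y)⁻¹)
    (h87 : ∀ x : Site d, InBox ((L : ℤ) • (y + e κ)) ((L : ℤ) • (y + e κ) + blockTop L) x →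
      uLev L u j x = (wrec L U₀ U₁ j x)⁻¹)
    (h13j : AgreeOn ((L : ℤ) • (y + e κ)) ((L : ℤ) • (y + e κ) + blockTop L) (avgIter L (mgauge U₀ u U₁ * U₀) j) Vj)
    (h13 : avgIter L (mgauge U₀ u U₁ * U₀) (j + 1) y κ = V y κ) :
    ((dbavgCovIter L U₀ U₁ (j + 1) y κ : 𝔸ˣ) : 𝔸)
      = ((V y κ * (avgIter L U₀ (j + 1) y κ)⁻¹ : 𝔸ˣ) : 𝔸)
          * (((avgIter L U₀ (j + 1) y κ : 𝔸ˣ) : 𝔸)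
              * exp (Complex.I • crossSum L (avgIter L U₀ j) (pert Vj (avgIter L U₀ j)) ((L : ℤ) • (y + e κ)))
              * (((avgIter L U₀ (j + 1) y κ)⁻¹ : 𝔸ˣ) : 𝔸)) := by
  have hp : uLev L u j ((L : ℤ) • (y + e κ)) = (wrec L U₀ U₁ j ((L : ℤ) • (y + e κ)))⁻¹ :=
    h87 _ (inBox_corner hL (y + e κ))
  have h130 := eq130_crossing_mirrored L U₀ U₁ u j y κ hm hp
  rw [tildIter_apply, h13] at h130
  have hsol : dbavgCovIter L U₀ U₁ (j + 1) y κ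
      = V y κ * (avgIter L U₀ (j + 1) y κ)⁻¹
          * Rc (avgIter L U₀ (j + 1) y κ)
              (wframe L (avgIter L U₀ j) (dbavgCovIter L U₀ U₁ j) ((L : ℤ) • (y + e κ))) := by
    rw [h130, inv_mul_cancel_right]
  have hpert : pert Vj (avgIter L U₀ j) * avgIter L U₀ j = Vj := by
    funext x μ
    simp only [Pi.mul_apply, pert, inv_mul_cancel_right]
  have hagree : AgreeOn ((L : ℤ) • (y + e κ)) ((L : ℤ) • (y + e κ) + blockTop L)
      (dbavgCovIter L U₀ U₁ j * avgIter L U₀ j) (pert Vj (avgIter L U₀ j) * avgIter L U₀ j) := by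
    rw [hpert]
    exact dbavg_agree_of_block L U₀ U₁ u j (y + e κ) Vj h87 h13j
  have hF : Fcov L (avgIter L U₀ j) (dbavgCovIter L U₀ U₁ j) ((L : ℤ) • (y + e κ))
      = ∑ r : Fin d → Fin L, (((L : ℝ) ^ d)⁻¹) •
          mlog ((covProd (avgIter L U₀ j) (pert Vj (avgIter L U₀ j)) ((L : ℤ) • (y + e κ))
            (treeWord (boxVec L r)) : 𝔸ˣ) : 𝔸) := by
    unfold Fcov
    refine Finset.sum_congr rfl fun r _ => ?_
    rw [tHol_congr_of_agree L hL _ _ _ (y + e κ) hagree r, covProd_eq_tHol _ _ _ _ (treeWord_boxVec_forward L r)]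
  rw [hsol]
  simp only [Units.val_mul, Rc_apply, wframe, val_expUnit, hF, ← I_smul_crossSum]

/-- … and `= exp iB_b` with `B_b = B8Thm2LogB.BcrossMirror L Ū₀ʲ V′ⱼ (L•b₊) g V′_b` inside the domain of the series logarithm
(the smallness is `B8Thm2LogB.ineq137_crossing_mirrored`'s business). [cite: Balaban1985RegularSpaces, (1.31) p.82] -/
theorem eq131_crossing_mirrored_expIB (L : ℕ) (hL : 1 ≤ L) (U₀ U₁ : Site d → Fin d → 𝔸ˣ) (u : Site d → 𝔸ˣ)
    (j : ℕ) (y : Site d) (κ : Fin d) (Vj V : Site d → Fin d → 𝔸ˣ)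
    (hm : uLev L u (j + 1) y = (wrec L U₀ U₁ (j + 1) y)⁻¹)
    (h87 : ∀ x : Site d, InBox ((L : ℤ) • (y + e κ)) ((L : ℤ) • (y + e κ) + blockTop L) x →
      uLev L u j x = (wrec L U₀ U₁ j x)⁻¹)
    (h13j : AgreeOn ((L : ℤ) • (y + e κ)) ((L : ℤ) • (y + e κ) + blockTop L) (avgIter L (mgauge U₀ u U₁ * U₀) j) Vj)
    (h13 : avgIter L (mgauge U₀ u U₁ * U₀) (j + 1) y κ = V y κ)
    (hsmall : ‖((V y κ * (avgIter L U₀ (j + 1) y κ)⁻¹ : 𝔸ˣ) : 𝔸)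
          * (((avgIter L U₀ (j + 1) y κ : 𝔸ˣ) : 𝔸)
              * exp (Complex.I • crossSum L (avgIter L U₀ j) (pert Vj (avgIter L U₀ j)) ((L : ℤ) • (y + e κ)))
              * (((avgIter L U₀ (j + 1) y κ)⁻¹ : 𝔸ˣ) : 𝔸)) - 1‖ < 1) :
    ((dbavgCovIter L U₀ U₁ (j + 1) y κ : 𝔸ˣ) : 𝔸)
      = exp (Complex.I • BcrossMirror L (avgIter L U₀ j) (pert Vj (avgIter L U₀ j)) ((L : ℤ) • (y + e κ))
          (avgIter L U₀ (j + 1) y κ) (V y κ * (avgIter L U₀ (j + 1) y κ)⁻¹)) := by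
  rw [eq131_crossing_mirrored L hL U₀ U₁ u j y κ Vj V hm h87 h13j h13, BcrossMirror, smul_smul,
    mul_inv_cancel₀ Complex.I_ne_zero, one_smul, exp_mlog hsmall]

end Carriers


/-! ## §7 (v1.2) Theorem 2's line (1.36)–(1.37): «Q_j(U₀, ηA) = B on Λ_j, B is given by formula (1.31) with V′ = Ũ′ʲ,
|B| < 2dLα₁ by the assumption (1.35)» — ON THE CERTIFIED AVERAGES (no prescribed `V`: Theorem 2's hypotheses
(1.33)–(1.35) replace the equalities (1.13) by the inequality (1.35)); `B8Thm2LogB.ineq137_*` supply the bound,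
§4–§5 the identification `exp iB_b = (Ū₁ʲ)_b` -/

section Thm2Line

variable {𝔸 : Type*} [NormedRing 𝔸] [NormOneClass 𝔸] [NormedAlgebra ℂ 𝔸] [CompleteSpace 𝔸]

/-- **(1.36)–(1.37) on an interior bond** `b ⊂ Λ_j`: with `B_b := (1/i) log Ũ′ʲ_b` ((1.31) first line with `V′ = Ũ′ʲ`,
`B8Thm2LogB.Bint`), (87) at `b₋`, `b₊`, `Ū₀ʲ_b ∈ U1` and (1.35) `|(U′U₀)‾ʲ_b − Ū₀ʲ_b| ≤ α₁` (`d, L ≥ 1`, `0 < α₁`, `dLα₁ ≤ 1/8`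
as in `B8Thm2LogB`): `exp iB_b = (Ū₁ʲ)_b` (print: «(1/i) log Ū₁ʲ = B», i.e. «Q_j(U₀, ηA) = B») AND `|B_b| < 2dLα₁`
(`B8Thm2LogB.ineq137_interior`). [cite: Balaban1985RegularSpaces, (1.36)–(1.37) p.82, (1.35) p.82, (1.31) p.82] -/
theorem eq137_interior (L : ℕ) (hd : 1 ≤ d) (hL : 1 ≤ L) (U₀ U₁ : Site d → Fin d → 𝔸ˣ) (u : Site d → 𝔸ˣ) (j : ℕ)
    (y : Site d) (κ : Fin d) (hm : uLev L u j y = (wrec L U₀ U₁ j y)⁻¹)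
    (hp : uLev L u j (y + e κ) = (wrec L U₀ U₁ j (y + e κ))⁻¹) (h₀ : avgIter L U₀ j y κ ∈ U1 𝔸) {α₁ : ℝ}
    (hα : 0 < α₁) (hsmall : (d : ℝ) * L * α₁ ≤ 1 / 8)
    (h135 : ‖(avgIter L (mgauge U₀ u U₁ * U₀) j y κ : 𝔸) - (avgIter L U₀ j y κ : 𝔸)‖ ≤ α₁) :
    exp (Complex.I • Bint (tildIter L U₀ (mgauge U₀ u U₁) j y κ)) = ((dbavgCovIter L U₀ U₁ j y κ : 𝔸ˣ) : 𝔸)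
      ∧ ‖Bint (tildIter L U₀ (mgauge U₀ u U₁) j y κ)‖ < 2 * d * L * α₁ := by
  have hw : ‖((tildIter L U₀ (mgauge U₀ u U₁) j y κ : 𝔸ˣ) : 𝔸) - 1‖ ≤ α₁ := by
    rw [tildIter_apply]
    exact (B8Thm2LogB.norm_mul_inv_sub_one_le _ h₀).trans h135
  have hd' : (1 : ℝ) ≤ d := by exact_mod_cast hd
  have hL' : (1 : ℝ) ≤ L := by exact_mod_cast hL
  have hdL : (1 : ℝ) ≤ (d : ℝ) * L := by nlinarith
  have hα1 : α₁ < 1 := by nlinarith [mul_nonneg (sub_nonneg.2 hdL) hα.le]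
  refine ⟨?_, B8Thm2LogB.ineq137_interior L hd hL hα hsmall hw⟩
  rw [exp_I_smul_Bint (hw.trans_lt hα1), eq130_interior L U₀ U₁ u j y κ hm hp]

/-- **(1.36)–(1.37) on a crossing bond** `b₋ ∈ Λ_{j−1}`, `b₊ ∈ Λ_j` (stated one level up): with `B_b := (1/i) log(exp[−i Σ_{x∈B(b₋)}
L^{−d}(1/i) log(R̄ʲ_{0,b₋}Ũ′ʲ)(Γ_{b₋,x})] Ũ′^{j+1}_b)` ((1.31) second line with `V′ = Ũ′`, `B8Thm2LogB.Bcross`), (87) at the sites of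
the block `B(b₋)` and at `b₊`, `U1`-valued averages and (1.35) on the bonds of `B(b₋)` (level `j`) and at `b` (level `j + 1`)
— exactly the data of `B8Thm2LogB.ineq137_of_ineq135` —: `exp iB_b = (Ū₁^{j+1})_b` AND `|B_b| < 2dLα₁`.  The identification is
`eq131_crossing` at `V := (U′U₀)‾` (for which (1.13) is tautological); the smallness putting `exp[−iΣ]Ũ′_b` inside the domain of
`log` is `B8Thm2LogB`'s count (`norm_crossSum_le`, `norm_crossMid_sub_one_le`, `arith137`).
[cite: Balaban1985RegularSpaces, (1.36)–(1.37) p.82, (1.35) p.82, (1.31) p.82, Theorem 2 p.83] -/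
theorem eq137_crossing (L : ℕ) (hd : 1 ≤ d) (hL : 1 ≤ L) (U₀ U₁ : Site d → Fin d → 𝔸ˣ) (u : Site d → 𝔸ˣ) (j : ℕ)
    (y : Site d) (κ : Fin d)
    (h87 : ∀ x : Site d, InBox ((L : ℤ) • y) ((L : ℤ) • y + blockTop L) x → uLev L u j x = (wrec L U₀ U₁ j x)⁻¹)
    (hp : uLev L u (j + 1) (y + e κ) = (wrec L U₀ U₁ (j + 1) (y + e κ))⁻¹)
    (hU : ∀ x μ, avgIter L (mgauge U₀ u U₁ * U₀) j x μ ∈ U1 𝔸) (hV₀ : ∀ x μ, avgIter L U₀ j x μ ∈ U1 𝔸)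
    (hW : avgIter L (mgauge U₀ u U₁ * U₀) (j + 1) y κ ∈ U1 𝔸) (hW₀ : avgIter L U₀ (j + 1) y κ ∈ U1 𝔸)
    {α₁ : ℝ} (hα : 0 < α₁) (hsmall : (d : ℝ) * L * α₁ ≤ 1 / 8)
    (h135 : ∀ (z : Site d) (μ : Fin d), (L : ℤ) • y ≤ z → z + e μ ≤ (L : ℤ) • y + blockTop L →
      ‖(avgIter L (mgauge U₀ u U₁ * U₀) j z μ : 𝔸) - (avgIter L U₀ j z μ : 𝔸)‖ ≤ α₁)
    (h135b : ‖(avgIter L (mgauge U₀ u U₁ * U₀) (j + 1) y κ : 𝔸) - (avgIter L U₀ (j + 1) y κ : 𝔸)‖ ≤ α₁) :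
    exp (Complex.I • Bcross L (avgIter L U₀ j) (tildIter L U₀ (mgauge U₀ u U₁) j) ((L : ℤ) • y)
        (tildIter L U₀ (mgauge U₀ u U₁) (j + 1) y κ))
        = ((dbavgCovIter L U₀ U₁ (j + 1) y κ : 𝔸ˣ) : 𝔸)
      ∧ ‖Bcross L (avgIter L U₀ j) (tildIter L U₀ (mgauge U₀ u U₁) j) ((L : ℤ) • y)
          (tildIter L U₀ (mgauge U₀ u U₁) (j + 1) y κ)‖ < 2 * d * L * α₁ := by
  -- the bound and the smallness: `B8Thm2LogB` §4–§5 verbatim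
  have hbd := (B8Thm2LogB.ineq137_of_ineq135 L hd hL hα hsmall (avgIter L (mgauge U₀ u U₁ * U₀) j) (avgIter L U₀ j)
    hU hV₀ ((L : ℤ) • y) h135 hW hW₀ h135b).2
  rw [pert_avgIter_eq_tildIter, ← tildIter_apply] at hbd
  refine ⟨?_, hbd⟩
  -- `exp[−iΣ]Ũ′_b` lies inside the domain of `log`
  have hw1 : avgIter L (mgauge U₀ u U₁ * U₀) (j + 1) y κ * (avgIter L U₀ (j + 1) y κ)⁻¹ ∈ U1 𝔸 :=
    (U1 𝔸).mul_mem hW ((U1 𝔸).inv_mem hW₀)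
  have hw : ‖((avgIter L (mgauge U₀ u U₁ * U₀) (j + 1) y κ * (avgIter L U₀ (j + 1) y κ)⁻¹ : 𝔸ˣ) : 𝔸) - 1‖ ≤ α₁ :=
    (B8Thm2LogB.norm_mul_inv_sub_one_le _ hW₀).trans h135b
  have hs : B8Thm2LogB.BondSmall (pert (avgIter L (mgauge U₀ u U₁ * U₀) j) (avgIter L U₀ j)) ((L : ℤ) • y)
      ((L : ℤ) • y + blockTop L) α₁ := fun z μ hz hzμ =>
    (B8Thm2LogB.norm_pert_sub_one_le _ _ z μ (hV₀ z μ)).trans (h135 z μ hz hzμ)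
  have hd' : (1 : ℝ) ≤ d := by exact_mod_cast hd
  have hL' : (1 : ℝ) ≤ L := by exact_mod_cast hL
  set n : ℝ := d * ((L : ℝ) - 1) with hndef
  have hn : 0 ≤ n := by rw [hndef]; nlinarith
  have hn1 : (n + 1) * α₁ ≤ (d : ℝ) * L * α₁ := by rw [hndef]; nlinarith
  have hA := B8Thm2LogB.arith137 hn hα (hn1.trans hsmall)
  have hτ : n * α₁ < 1 := by nlinarith
  have hS := B8Thm2LogB.norm_crossSum_le L hL (avgIter L U₀ j) _ hV₀ (B8Thm2LogB.pert_mem hU hV₀) ((L : ℤ) • y) hα.le hs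
    (by rw [← hndef]; exact hτ)
  rw [← hndef] at hS
  have hmid := B8Thm2LogB.norm_crossMid_sub_one_le L (avgIter L U₀ j) _ ((L : ℤ) • y) hS (mem_U1.mp hw1).1 hw
  have hlt : ‖crossMid L (avgIter L U₀ j) (pert (avgIter L (mgauge U₀ u U₁ * U₀) j) (avgIter L U₀ j)) ((L : ℤ) • y)
      (avgIter L (mgauge U₀ u U₁ * U₀) (j + 1) y κ * (avgIter L U₀ (j + 1) y κ)⁻¹) - 1‖ < 1 :=
    hmid.trans_lt hA.1
  -- the identification `exp iB_b = exp[−iΣ]Ũ′_b = (U̿₁)_b` (§5 at `V := (U′U₀)‾`, (1.13) tautological)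
  have hid := eq131_crossing L hL U₀ U₁ u j y κ (avgIter L (mgauge U₀ u U₁ * U₀) j)
    (avgIter L (mgauge U₀ u U₁ * U₀) (j + 1)) h87 (fun _ _ _ _ => rfl) hp rfl
  have hexp := exp_I_smul_Bcross L _ _ _ hlt
  rw [pert_avgIter_eq_tildIter] at hexp hid
  rw [← hid] at hexp
  rw [tildIter_apply]
  exact hexp

end Thm2Line

end Literature.MathematicalPhysics.QuantumFieldTheory.Balaban1983to89.B8Eq131Derivation
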